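import Summits.QuantumFields.BalabanUV.Beta.BorderedHessianKernelAction
import Summits.QuantumFields.BalabanUV.Beta.ValueHessianBlind
import Literature.MathematicalPhysics.QuantumFieldTheory.Balaban1983to89.Beta.ResolventComposition

/-!
# `BalabanUV.Beta.GAN24.ValueHessianLevelZero` — binder row G-an2-4 ∕ (CONV-C), W-slot (α-0), typer's PART VI row **T6-VAL**, the (γ) hand's letter **K7-0**
# (memo `HOME/b2b-balaban-gan24-formalise-leaf-06/g55/HX-VALUES-g55.md` §6): **AT LEVEL `0` an2's VALUE HESSIAN `E2 d Lc 0` IS THE WILSON HESSIAN `d*d`** —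
# `E2 d Lc 0 x y (inl κ) (inl l) = (d*d δ_{(l,y)})_κ(x) = bhK_N(x,y)_{inl κ, inl l}`, hence `Σ'_y Σ_l E2_0(x,y)_{κl}·q l y = (d*d q)_κ(x)` for EVERY 1-form `q`
# (G-an2-4 CRUX TEAM (2), seat `b2b-balaban-gan24-formalise-leaf-06` = the (γ) hand, gen 57; journal [GAN24LEAF06-G57-INTENT-1])

NOT IN PRINT; OUR BOOKKEEPING ([folklore] three-line bookkeeping BY NAME over an5's bottom level `ResolventComposition.wH_one` (`ℋ_1 = 𝟙`), the gauge-free Euler–Lagrange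
row of the minimiser column `ResolventComposition.wH_EL'` (`d*d ℋ_l = 𝒬ᵀ wΦ_l`) and `contourSumAdj_one`, `KernelSpecInstance.curv_shift ∕ curvAdj_shift`; an2's `BalabanStepJetsSucc.E2` ∕ `ValueHessianBlind.E2_inl_inl_eq_wΦ`;
an2 gen 13's `BorderedHessianKernelAction.bhK_inl_inl_eq ∕ tsum_bhK_inl_inl`; 0 `def`, 0 cited fact, 0 `def … : Prop`, 0 sorry).
HONEST FRAMING (cell contract, verbatim): «discharging `BetaPertH` makes Bałaban's UV stability UNCONDITIONAL — a real constructive-QFT result; it is NOT the continuum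
limit and NOT the Clay problem.»  HONEST DEPENDENCY (verbatim): «continuum YM on T⁴ ⇐ BetaPertH ∧ nine spine estimates (0/9 proved); BetaPertH ⇐ (D1) ∧ (D4) ∧ CAP+tail;
G-an2-4 gates asym, D1 and NE2/3/4.»

WHY.  The depth tower of row T6-VAL (this lineage's `CrossedLedgerTelescope`, leaf-03's `CrossedLedgerClosure`) is written for the levels `≥ 1`, where the exchange words
of the E-frame forcing are sandwiches `E2_{j+1} ∘ G_{j+1} ∘ E2_{j+1}` (L4 `StepCovarianceSandwich`, K5 `StepCovarianceCellPairingTent`).  At LEVEL `0` the forcing is the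
Wilson cubic through the level-`0` step covariance `G_0 = coDressKBmAt ρ Lc (KInvStep Lc 0)` and its face currents are `−½·curvAdj` of plaquette columns (leaf-04's
`WilsonFaceHalfVertex`), i.e. `d*d` of bounded periodic pre-images.  THIS FILE says that `d*d` IS `E2 d Lc 0` as a kernel — so the level-`0` words are the SAME sandwiches
with `j + 1 ↦ 0`, and K7-0 becomes K7-a's twin (`StepCovarianceSandwichZero`, this seat's next file).

WHAT ([folklore]; generic `d`, `Lc ≥ 1` via `NeZero`):
* §1 `wΦ_eq_curvAdj_curv_of_eq_one` — at blocking factor `1` the multiplier response kernel is the Wilson Hessian read on indicators: `wΦ_1 μ l x = (d*d δ_{(l,0)})_μ(x)`;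
* §2 **`E2_zero_inl_inl`** — `E2 d Lc 0 x y (inl κ)(inl l) = (d*d δ_{(l,y)})_κ(x)`; **`E2_zero_inl_inl_eq_bhK`** — `= bhK N x y (inl κ)(inl l)` (every `N`: the window is redundant);
* §3 **`tsum_E2_zero_apply`** — `Σ'_y Σ_l E2_0(x,y)_{inl κ, inl l}·X y z (inl l) b = (d*d X_{·zb})_κ(x)` for EVERY kernel `X` (finite support; no summability hypothesis);
  `tsum_E2_zero_apply_form` — the same for a 1-form `q`: `Σ'_y Σ_l E2_0(x,y)_{κl}·q l y = curvAdj (curv q) κ x`.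
Asserts NO value of Bałaban's tables; discharges NOTHING of `hX` ∕ `hXu` ∕ (C)_{≥1} ∕ `hB0` ∕ `hBF` ∕ (Q-L); NEVER «G-an2-4 closed» as (CONV-C); NOT D1, NOT `BetaPertH`, NOT continuum,
NOT Clay.  2026-08-24; no existing file touched.
-/

noncomputable section

open Finset
open scoped BigOperators
open Literature.MathematicalPhysics.QuantumFieldTheory
open Literature.MathematicalPhysics.QuantumFieldTheory.Balaban1983to89
open Literature.MathematicalPhysics.QuantumFieldTheory.Balaban1983to89.Beta
open ExpKernelCalculus (MKer)
open AffineAveraging (Form1 curv curvAdj)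
open AffineReproduction (contourSumAdj)
open KKTFluctuationKernel (delta1 delta1_apply)
open KernelSpecInstance (wH wΦ curv_shift curvAdj_shift)
open OneStepResolventKernel (Fib)
open BalabanStepJetsSucc (E2)
open ResolventComposition (wH_one wH_EL' contourSumAdj_one)
open Summit.QuantumFields.BalabanUV.Beta.BorderedHessian (bhK bhK_inl_inl_eq fcol tsum_bhK_inl_inl E2_inl_inl_eq_wΦ)

namespace Summit.QuantumFields.BalabanUV.Beta.GAN24.ValueHessianLevelZero

variable {d : ℕ}

/-! ## §1 At blocking factor `1` the multiplier response kernel is the Wilson Hessian -/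

/-- [folklore] **`wΦ_1 = d*d` ON INDICATORS**: at blocking factor `1` (every bond its own block) the multiplier response to a prescribed average `δ_{(l,0)}` is the Wilson
Hessian of that indicator — the gauge-free Euler–Lagrange row `d*d ℋ_l = 𝒬ᵀ_1 wΦ_l` (`wH_EL'`) with `ℋ_1 = 𝟙` (`wH_one`) and `𝒬ᵀ_1 = id` (`contourSumAdj_one`). -/
theorem wΦ_eq_curvAdj_curv_of_eq_one {N : ℕ} [NeZero N] (hN : N = 1) (μ l : Fin (d + 1)) (x : AffineAveraging.Site (d + 1)) :
    wΦ (N := N) (d := d) μ l x = curvAdj (curv (delta1 l 0)) μ x := by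
  have h := wH_EL' (N := N) (d := d) l μ x
  have e : (fun κ z => wH (N := N) (d := d) κ l z) = delta1 l 0 := by
    funext κ z
    rw [wH_one hN, delta1_apply]
    simp only [and_comm]
  rw [e] at h
  subst hN
  rw [contourSumAdj_one] at h
  exact h.symm

/-! ## §2 The level-`0` value Hessian is the Wilson Hessian kernel -/

/-- [folklore] Translating the source of an indicator translates its Wilson Hessian: `(d*d δ_{(l,0)})_κ(x − y) = (d*d δ_{(l,y)})_κ(x)`. -/
theorem curvAdj_curv_delta1_sub (l κ : Fin (d + 1)) (x y : AffineAveraging.Site (d + 1)) :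
    curvAdj (curv (delta1 (d := d) l 0)) κ (x - y) = curvAdj (curv (delta1 l y)) κ x := by
  have hδ : delta1 (d := d) l y = fun m z => delta1 (d := d) l 0 m (z - y) := by
    funext m z
    simp only [delta1_apply, sub_eq_zero]
  rw [hδ, curv_shift, curvAdj_shift]

/-- NOT IN PRINT; OUR BOOKKEEPING.  **`E2 d Lc 0` IS THE WILSON HESSIAN**: for every `Lc ≥ 1`, `E2 d Lc 0 x y (inl κ) (inl l) = (d*d δ_{(l,y)})_κ(x)` — an2's value Hessian of the
step-`0` lattice (`mmRead 1 (KInv 1)`, the multiplier block of the trivial blocking) is the second differential of the Wilson action at the unit background, read on indicator 1-forms. -/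
theorem E2_zero_inl_inl (Lc : ℕ) [NeZero Lc] (x y : Fin (d + 1) → ℤ) (κ l : Fin (d + 1)) :
    E2 d Lc 0 x y (Sum.inl κ) (Sum.inl l) = curvAdj (curv (delta1 l y)) κ x := by
  rw [E2_inl_inl_eq_wΦ, wΦ_eq_curvAdj_curv_of_eq_one (N := Lc ^ 0) (pow_zero Lc) κ l (x - y), curvAdj_curv_delta1_sub]

/-- NOT IN PRINT; OUR BOOKKEEPING.  **… AND IT IS THE FIELD–FIELD BLOCK OF THE UNDRESSED BORDERED HESSIAN** `bhK N` (an2 gen 13), for every blocking `N` (the window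
`[y − x ∈ cube 2]` of `bhK` is the locality radius of `d*d`, `BorderedHessianKernelAction.bhK_inl_inl_eq`). -/
theorem E2_zero_inl_inl_eq_bhK (Lc : ℕ) [NeZero Lc] (N : ℕ) (x y : Fin (d + 1) → ℤ) (κ l : Fin (d + 1)) :
    E2 d Lc 0 x y (Sum.inl κ) (Sum.inl l) = bhK (d := d) N x y (Sum.inl κ) (Sum.inl l) := by
  rw [E2_zero_inl_inl, bhK_inl_inl_eq]

/-! ## §3 The level-`0` value Hessian applied: `d*d` of the column -/

/-- NOT IN PRINT; OUR BOOKKEEPING.  **`E2_0` APPLIED TO A FIELD COLUMN IS `d*d` OF THAT COLUMN**: for EVERY kernel `X` (the row of `E2_0` is finitely supported, no summability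
hypothesis), `Σ'_y Σ_l E2 d Lc 0 x y (inl κ)(inl l)·X y z (inl l) b = (d*d X_{·zb})_κ(x)` (`tsum_bhK_inl_inl` through §2). -/
theorem tsum_E2_zero_apply (Lc : ℕ) [NeZero Lc] (X : MKer (d + 1) (Fib d)) (x z : Fin (d + 1) → ℤ) (κ : Fin (d + 1)) (b : Fib d) :
    (∑' y, ∑ l : Fin (d + 1), E2 d Lc 0 x y (Sum.inl κ) (Sum.inl l) * X y z (Sum.inl l) b) = curvAdj (curv (fcol X z b)) κ x := by
  have e : ∀ y, (∑ l : Fin (d + 1), E2 d Lc 0 x y (Sum.inl κ) (Sum.inl l) * X y z (Sum.inl l) b) =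
      ∑ l : Fin (d + 1), bhK (d := d) Lc x y (Sum.inl κ) (Sum.inl l) * X y z (Sum.inl l) b := fun y =>
    Finset.sum_congr rfl fun l _ => by rw [E2_zero_inl_inl_eq_bhK Lc Lc]
  rw [tsum_congr e, tsum_bhK_inl_inl]

/-- NOT IN PRINT; OUR BOOKKEEPING.  **THE SAME FOR A 1-FORM**: `Σ'_y Σ_l E2 d Lc 0 x y (inl κ)(inl l)·q l y = curvAdj (curv q) κ x` for EVERY `q : Form1`. -/
theorem tsum_E2_zero_apply_form (Lc : ℕ) [NeZero Lc] (q : Form1 (d + 1) ℝ) (x : Fin (d + 1) → ℤ) (κ : Fin (d + 1)) :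
    (∑' y, ∑ l : Fin (d + 1), E2 d Lc 0 x y (Sum.inl κ) (Sum.inl l) * q l y) = curvAdj (curv q) κ x := by
  have h := tsum_E2_zero_apply Lc (fun y _ a _ => match a with | Sum.inl l => q l y | Sum.inr _ => 0) x 0 κ (Sum.inl κ)
  exact h

/-- NOT IN PRINT; OUR BOOKKEEPING.  **THE TRANSPOSED READING** (symmetry of `E2` on field legs is not even needed: `E2_0(y,x)_{lκ} = (d*d δ_{(κ,x)})_l(y)` and `d*d` is symmetric):
`Σ'_y Σ_l E2 d Lc 0 y x (inl l)(inl κ)·q l y = curvAdj (curv q) κ x`. -/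
theorem tsum_E2_zero_apply_form' (Lc : ℕ) [NeZero Lc] (q : Form1 (d + 1) ℝ) (x : Fin (d + 1) → ℤ) (κ : Fin (d + 1)) :
    (∑' y, ∑ l : Fin (d + 1), E2 d Lc 0 y x (Sum.inl l) (Sum.inl κ) * q l y) = curvAdj (curv q) κ x := by
  rw [← tsum_E2_zero_apply_form Lc q x κ]
  refine tsum_congr fun y => Finset.sum_congr rfl fun l _ => ?_
  rw [E2_inl_inl_eq_wΦ, E2_inl_inl_eq_wΦ, GAN24.TransverseDictionary.wΦ_symm]
  congr 2
  abel

end Summit.QuantumFields.BalabanUV.Beta.GAN24.ValueHessianLevelZero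

end
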